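import Summits.Ventures.YMGap.FlowData.RectTubeVacuumSector
import HarnessLib

/-!
# Venture YMGap, track Y3 FLOW-DATA — VACUUM FLATNESS at strong coupling (Harnack): the tube vacuum `Ω_J` satisfies
# `e^{−4c} ≤ Ω_J² ≤ e^{4c}` a.e., `c = |J|·n·(#P + N)`, hence `|⟨f⟩_{Ω_J} − ⟨f⟩_{Haar}| ≤ ‖f‖_∞ (e^{4c} − 1)` (theorems only)

HONEST FRAMING: venture file of the cell `pub-ymgap` (QuantumFields programme), track Y3 (FLOW-DATA), for the rectangular tube
`T_J = rectTubeTransferOperator ρ J Ls` (kernel `K_J = rectSliceKernel ρ J J`).  An elementary Harnack-type statement (NO operator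
perturbation theory): the slice kernel is pinched, `e^{−c} ≤ K_J ≤ e^{c}` pointwise with `c = |J|·n·(#P+N)` (`#P` spatial plaquettes,
`N` spatial links per slice), so the nonnegative vacuum `Ω = λ₀⁻¹ ∫ K(·,b)Ω(b)` is pinched between `e^{∓c}(∫Ω)/λ₀` and, being a unit
vector of a probability space, between `e^{−2c}` and `e^{2c}`; consequently vacuum expectations are Haar expectations up to
`‖f‖_∞ (e^{4c} − 1)` — the zeroth-order input of the strong-coupling dictionary (vacuum ≈ strong-coupling vacuum `1`).  Finite
spatial torus; an O(J) statement with explicit constant, useful only asymptotically (`β → 0⁺`); no number, no row; nothing about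
`L → ∞`, the continuum or a mass gap.

* abstract (probability space, pinched kernel `0 < m ≤ K ≤ M`, kernel operator `A`, nonnegative unit top eigenvector `Ω`):
  **`vacuum_sq_mem_Icc_ae`** (`(m/M)² ≤ Ω² ≤ (M/m)²` a.e.), **`abs_integral_mul_vacuum_sq_sub_integral_le`**
  (`|∫ f Ω² − ∫ f| ≤ B_f·((M/m)² − 1)` for `‖f‖ ≤ B_f`);
* the tube: `rectSliceKernel_mem_Icc_exp` (`e^{−c} ≤ K_J(a,b) ≤ e^{c}`), **`rectTube_abs_vacuum_expectation_sub_haar_le`**, and the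
  cell's `SU(2)` form **`su2_rectTube_abs_vacuum_expectation_sub_haar_le`** (`c = β·(#sites·k(k−1)/2 + #sites·k)`; e.g. the vacuum
  plaquette expectation `P_s(β)` is within `e^{4c} − 1` of its Haar value).

References: M. Reed, B. Simon IV (1978) §XIII.12 [cite: ReedSimonIV1978, §XIII.12]; I. Montvay, G. Münster (1994) §3.2.6
[cite: MontvayMunster1994, §3.2.6].
-/

noncomputable section

open scoped BigOperators ENNReal RealInnerProductSpace
open MeasureTheory Filter Function
open Literature.MathematicalPhysics.QuantumFieldTheory Literature.Analysis.OperatorTheory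
open Literature.MathematicalPhysics.QuantumLattice (RectTorusSite fundamentalRep continuous_fundamentalRep
  fundamentalRep_mem_unitaryGroup)
open Literature.Barriers.QuantumFields

namespace Summit.Ventures.YMGap.FlowData

/-! ### Abstract Harnack flatness of a nonnegative top eigenvector of a pinched kernel -/

section Abstract

variable {X : Type*} [MeasurableSpace X] {μ : Measure X} [IsProbabilityMeasure μ]
  {K : X → X → ℝ} {C : ℝ} {A : Lp ℝ 2 μ →L[ℝ] Lp ℝ 2 μ}

/-- **Pinched kernel ⇒ flat vacuum**: if `0 < m ≤ K ≤ M`, `A` is the kernel operator of `K`, and `Ω ≥ 0` a.e. is a unit vector with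
`AΩ = ‖A‖Ω`, `‖A‖ > 0`, then `(m/M)² ≤ Ω(x)² ≤ (M/m)²` for a.e. `x`. [folklore] -/
theorem vacuum_sq_mem_Icc_ae (hK : StronglyMeasurable (uncurry K)) (hC : ∀ x y, ‖K x y‖ ≤ C) {m M : ℝ} (hm : 0 < m)
    (hmK : ∀ x y, m ≤ K x y) (hKM : ∀ x y, K x y ≤ M)
    (hA : ∀ φ : Lp ℝ 2 μ, (A φ : X → ℝ) =ᵐ[μ] fun x => ∫ y, K x y * φ y ∂μ) (hA0 : 0 < ‖A‖)
    {Ω : Lp ℝ 2 μ} (h1 : ‖Ω‖ = 1) (hΩ : ∀ᵐ x ∂μ, 0 ≤ Ω x) (heig : A Ω = ‖A‖ • Ω) :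
    ∀ᵐ x ∂μ, (m / M) ^ 2 ≤ Ω x ^ 2 ∧ Ω x ^ 2 ≤ (M / m) ^ 2 := by
  have hM : 0 < M := by
    obtain ⟨x₀, -⟩ := nonempty_of_measure_ne_zero (μ := μ) (s := Set.univ) (by rw [measure_univ]; exact one_ne_zero)
    exact lt_of_lt_of_le hm ((hmK x₀ x₀).trans (hKM x₀ x₀))
  set lam : ℝ := ‖A‖ with hlam
  set I : ℝ := ∫ y, Ω y ∂μ with hI
  have hΩint : Integrable (Ω : X → ℝ) μ := (Lp.memLp Ω).integrable one_le_two
  have hI0 : 0 ≤ I := integral_nonneg_of_ae hΩ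
  -- the eigen-equation pointwise a.e.: `lam * Ω x = ∫ K x y Ω y`
  have heq : ∀ᵐ x ∂μ, lam * Ω x = ∫ y, K x y * Ω y ∂μ := by
    have h2 : ((‖A‖ • Ω : Lp ℝ 2 μ) : X → ℝ) =ᵐ[μ] fun x => ‖A‖ * Ω x := by
      filter_upwards [Lp.coeFn_smul ‖A‖ Ω] with x hx
      rw [hx, Pi.smul_apply, smul_eq_mul]
    have h3 : (A Ω : X → ℝ) =ᵐ[μ] fun x => ‖A‖ * Ω x := by rw [heig]; exact h2
    filter_upwards [hA Ω, h3] with x hxK hx3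
    rw [hlam, ← hx3, hxK]
  -- pinching of `∫ K x y Ω y` between `m I` and `M I`
  have hlo : ∀ x, m * I ≤ ∫ y, K x y * Ω y ∂μ := fun x => by
    rw [hI, ← integral_const_mul]
    exact integral_mono_ae (hΩint.const_mul m) (integrable_kernel_mul_coeFn hK hC Ω x)
      (by filter_upwards [hΩ] with y hy; exact mul_le_mul_of_nonneg_right (hmK x y) hy)
  have hhi : ∀ x, ∫ y, K x y * Ω y ∂μ ≤ M * I := fun x => by
    rw [hI, ← integral_const_mul]
    exact integral_mono_ae (integrable_kernel_mul_coeFn hK hC Ω x) (hΩint.const_mul M)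
      (by filter_upwards [hΩ] with y hy; exact mul_le_mul_of_nonneg_right (hKM x y) hy)
  have hpinch : ∀ᵐ x ∂μ, m * I / lam ≤ Ω x ∧ Ω x ≤ M * I / lam := by
    filter_upwards [heq] with x hx
    constructor
    · rw [div_le_iff₀ hA0, mul_comm (Ω x)]; rw [hx]; exact hlo x
    · rw [le_div_iff₀ hA0, mul_comm (Ω x)]; rw [hx]; exact hhi x
  -- `∫ Ω² = 1`
  have hΩ2 : Integrable (fun x => Ω x * Ω x) μ := integrable_mul Ω Ω
  have hΩ2one : ∫ x, Ω x * Ω x ∂μ = 1 := by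
    rw [← inner_eq_integral, real_inner_self_eq_norm_sq, h1, one_pow]
  have hlo1 : (m * I / lam) ^ 2 ≤ 1 := by
    have h := integral_mono_ae (integrable_const ((m * I / lam) ^ 2)) hΩ2
      (show (fun _ => (m * I / lam) ^ 2) ≤ᵐ[μ] fun x => Ω x * Ω x by
        filter_upwards [hpinch] with x hx
        have h0 : 0 ≤ m * I / lam := div_nonneg (mul_nonneg hm.le hI0) hA0.le
        nlinarith [hx.1, h0])
    rw [integral_const, smul_eq_mul, probReal_univ, one_mul, hΩ2one] at h
    exact h
  have hhi1 : 1 ≤ (M * I / lam) ^ 2 := by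
    have h := integral_mono_ae hΩ2 (integrable_const ((M * I / lam) ^ 2))
      (show (fun x => Ω x * Ω x) ≤ᵐ[μ] fun _ => (M * I / lam) ^ 2 by
        filter_upwards [hpinch, hΩ] with x hx hx0
        nlinarith [hx.2, hx0])
    rw [integral_const, smul_eq_mul, probReal_univ, one_mul, hΩ2one] at h
    exact h
  have hratio : M * I / lam = (M / m) * (m * I / lam) := by field_simp
  have hratio' : m * I / lam = (m / M) * (M * I / lam) := by field_simp
  filter_upwards [hpinch, hΩ] with x hx hx0
  have hMm : 0 ≤ M / m := div_nonneg hM.le hm.le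
  have hmM : 0 ≤ m / M := div_nonneg hm.le hM.le
  have hup : Ω x ^ 2 ≤ (M * I / lam) ^ 2 := by nlinarith [hx.2, hx0]
  have hdn : (m * I / lam) ^ 2 ≤ Ω x ^ 2 := by
    have h0 : 0 ≤ m * I / lam := div_nonneg (mul_nonneg hm.le hI0) hA0.le
    nlinarith [hx.1, h0]
  constructor
  · calc (m / M) ^ 2 = (m / M) ^ 2 * 1 := by ring
      _ ≤ (m / M) ^ 2 * (M * I / lam) ^ 2 := mul_le_mul_of_nonneg_left hhi1 (sq_nonneg _)
      _ = (m * I / lam) ^ 2 := by rw [hratio']; ring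
      _ ≤ Ω x ^ 2 := hdn
  · calc Ω x ^ 2 ≤ (M * I / lam) ^ 2 := hup
      _ = (M / m) ^ 2 * (m * I / lam) ^ 2 := by rw [hratio]; ring
      _ ≤ (M / m) ^ 2 * 1 := mul_le_mul_of_nonneg_left hlo1 (sq_nonneg _)
      _ = (M / m) ^ 2 := by ring

/-- **Vacuum expectations are Haar expectations up to `B_f·((M/m)² − 1)`**: `|∫ f Ω² − ∫ f| ≤ B_f ((M/m)² − 1)` for every bounded
strongly measurable `f` (`‖f‖ ≤ B_f`), under the hypotheses of `vacuum_sq_mem_Icc_ae`. [folklore] -/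
theorem abs_integral_mul_vacuum_sq_sub_integral_le (hK : StronglyMeasurable (uncurry K)) (hC : ∀ x y, ‖K x y‖ ≤ C) {m M : ℝ}
    (hm : 0 < m) (hmK : ∀ x y, m ≤ K x y) (hKM : ∀ x y, K x y ≤ M)
    (hA : ∀ φ : Lp ℝ 2 μ, (A φ : X → ℝ) =ᵐ[μ] fun x => ∫ y, K x y * φ y ∂μ) (hA0 : 0 < ‖A‖)
    {Ω : Lp ℝ 2 μ} (h1 : ‖Ω‖ = 1) (hΩ : ∀ᵐ x ∂μ, 0 ≤ Ω x) (heig : A Ω = ‖A‖ • Ω)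
    {f : X → ℝ} (hf : StronglyMeasurable f) {Bf : ℝ} (hBf : ∀ x, ‖f x‖ ≤ Bf) :
    |∫ x, f x * (Ω x * Ω x) ∂μ - ∫ x, f x ∂μ| ≤ Bf * ((M / m) ^ 2 - 1) := by
  have hM : 0 < M := by
    obtain ⟨x₀, -⟩ := nonempty_of_measure_ne_zero (μ := μ) (s := Set.univ) (by rw [measure_univ]; exact one_ne_zero)
    exact lt_of_lt_of_le hm ((hmK x₀ x₀).trans (hKM x₀ x₀))
  have hflat := vacuum_sq_mem_Icc_ae hK hC hm hmK hKM hA hA0 h1 hΩ heig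
  have hΩ2 : Integrable (fun x => Ω x * Ω x) μ := integrable_mul Ω Ω
  have hfi : Integrable f μ := (integrable_const Bf).mono' hf.aestronglyMeasurable (Eventually.of_forall hBf)
  have hfΩ : Integrable (fun x => f x * (Ω x * Ω x)) μ := hΩ2.bdd_mul hf.aestronglyMeasurable (Eventually.of_forall hBf)
  -- `(M/m)² − 1 ≥ 1 − (m/M)²`, so `|Ω² − 1| ≤ (M/m)² − 1` a.e.
  have hMm1 : 1 ≤ M / m := by
    rw [le_div_iff₀ hm, one_mul]
    obtain ⟨x₀, -⟩ := nonempty_of_measure_ne_zero (μ := μ) (s := Set.univ) (by rw [measure_univ]; exact one_ne_zero)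
    exact (hmK x₀ x₀).trans (hKM x₀ x₀)
  have hdev : ∀ᵐ x ∂μ, |Ω x * Ω x - 1| ≤ (M / m) ^ 2 - 1 := by
    filter_upwards [hflat] with x hx
    rw [← pow_two] 
    rw [abs_le]
    constructor
    · -- `-( (M/m)^2 - 1 ) ≤ Ω² − 1` from `(m/M)² ≤ Ω²` and `(m/M)² ≥ 2 − (M/m)²`? use `(m/M)^2 * (M/m)^2 = 1`
      have hprod : (m / M) ^ 2 * (M / m) ^ 2 = 1 := by field_simp
      nlinarith [hx.1, hMm1, sq_nonneg (M / m - 1), hprod]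
    · linarith [hx.2]
  rw [← integral_sub hfΩ hfi]
  calc |∫ x, f x * (Ω x * Ω x) - f x ∂μ| ≤ ∫ x, |f x * (Ω x * Ω x) - f x| ∂μ := abs_integral_le_integral_abs
    _ ≤ ∫ x, Bf * ((M / m) ^ 2 - 1) ∂μ := by
        refine integral_mono_ae (hfΩ.sub hfi).abs (integrable_const _) ?_
        filter_upwards [hdev] with x hx
        rw [show f x * (Ω x * Ω x) - f x = f x * (Ω x * Ω x - 1) by ring, abs_mul]
        exact mul_le_mul ((Real.norm_eq_abs _).symm.le.trans (hBf x)) hx (abs_nonneg _)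
          ((norm_nonneg _).trans (hBf x))
    _ = Bf * ((M / m) ^ 2 - 1) := by rw [integral_const, smul_eq_mul, probReal_univ, one_mul]

end Abstract

/-! ### The tube: the slice kernel is pinched `e^{−c} ≤ K_J ≤ e^{c}` -/

section Tube

variable {G : Type*} [Group G] [TopologicalSpace G] [IsTopologicalGroup G] [CompactSpace G]
  [MeasurableSpace G] [BorelSpace G] [SecondCountableTopology G] {n k : ℕ} (ρ : G →* Matrix (Fin n) (Fin n) ℂ)
  {Ls : Fin k → ℕ} [∀ i, NeZero (Ls i)]

/-- **Pinching of the slice kernel**: `e^{−c} ≤ K_J(a,b) ≤ e^{c}` with `c = |J|·n·(#sites·k(k−1)/2 + #sites·k)` (unitary `ρ`: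
`|mag| ≤ n#P`, `|elec| ≤ nN`). [folklore] -/
theorem rectSliceKernel_mem_Icc_exp (hρ : Continuous ρ) (hρu : ∀ g, ρ g ∈ Matrix.unitaryGroup (Fin n) ℂ) (J : ℝ)
    (a b : RectSlice Ls G) :
    Real.exp (-(|J| * (n * (Fintype.card (RectTorusSite Ls) * Fintype.card {p : Fin k × Fin k // p.1 < p.2} +
        Fintype.card (RectTorusSite Ls × Fin k))))) ≤ rectSliceKernel (Ls := Ls) ρ J J a b ∧
    rectSliceKernel (Ls := Ls) ρ J J a b ≤ Real.exp (|J| * (n * (Fintype.card (RectTorusSite Ls) *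
        Fintype.card {p : Fin k × Fin k // p.1 < p.2} + Fintype.card (RectTorusSite Ls × Fin k)))) := by
  set P : ℝ := (Fintype.card (RectTorusSite Ls) : ℝ) * (Fintype.card {p : Fin k × Fin k // p.1 < p.2} : ℝ) with hP
  set N : ℝ := (Fintype.card (RectTorusSite Ls × Fin k) : ℝ) with hN
  have htr : ∀ g : G, |(ρ g).trace.re| ≤ n := fun g =>
    (Complex.abs_re_le_norm _).trans (FiniteTemperature.norm_trace_le_of_mem_unitaryGroup (hρu _))
  have hmag : ∀ c : RectSlice Ls G, |rectMagSum (Ls := Ls) ρ c| ≤ n * P := by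
    intro c
    unfold rectMagSum
    refine (Finset.abs_sum_le_sum_abs _ _).trans ?_
    refine (Finset.sum_le_sum fun x _ => (Finset.abs_sum_le_sum_abs _ _).trans
      (Finset.sum_le_sum fun p _ => htr _)).trans (le_of_eq ?_)
    simp only [Finset.sum_const, Finset.card_univ, hP]
    ring
  have helec : ∀ E : RectTorusSite Ls → G, |rectElecSum (Ls := Ls) ρ a E b| ≤ n * N := by
    intro E
    unfold rectElecSum
    refine (Finset.abs_sum_le_sum_abs _ _).trans ?_
    refine (Finset.sum_le_sum fun x _ => (Finset.abs_sum_le_sum_abs _ _).trans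
      (Finset.sum_le_sum fun i _ => htr _)).trans (le_of_eq ?_)
    simp only [Finset.sum_const, Finset.card_univ, hN, Fintype.card_prod, Fintype.card_fin]
    push_cast; ring
  have hc1 : ∀ y : RectTorusSite Ls, Continuous fun E : RectTorusSite Ls → G => E y := fun y => continuous_apply y
  have hq : Continuous fun E : RectTorusSite Ls → G => rectElecSum (Ls := Ls) ρ a E b := by
    unfold rectElecSum
    refine continuous_finsetSum _ fun x _ => continuous_finsetSum _ fun i _ => ?_
    exact (Complex.continuous_re.comp (Continuous.matrix_trace hρ)).comp
      ((((hc1 x).mul continuous_const).mul (hc1 _).inv).mul continuous_const)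
  have hEi : Integrable (fun E : RectTorusSite Ls → G => Real.exp (J * rectElecSum (Ls := Ls) ρ a E b))
      (Measure.pi fun _ : RectTorusSite Ls => haarProbability G) :=
    (Real.continuous_exp.comp (continuous_const.mul hq)).integrable_of_hasCompactSupport (HasCompactSupport.of_compactSpace _)
  -- bounds on the three factors
  have hmf : ∀ c : RectSlice Ls G, Real.exp (-(|J| * (n * P) / 2)) ≤ Real.exp (J / 2 * rectMagSum (Ls := Ls) ρ c) ∧
      Real.exp (J / 2 * rectMagSum (Ls := Ls) ρ c) ≤ Real.exp (|J| * (n * P) / 2) := by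
    intro c
    have h := abs_le.1 (hmag c)
    have hJ : |J / 2 * rectMagSum (Ls := Ls) ρ c| ≤ |J| * (n * P) / 2 := by
      rw [abs_mul, abs_div, abs_two]
      calc |J| / 2 * |rectMagSum (Ls := Ls) ρ c| ≤ |J| / 2 * (n * P) := mul_le_mul_of_nonneg_left (hmag c) (by positivity)
        _ = |J| * (n * P) / 2 := by ring
    have hJ' := abs_le.1 hJ
    exact ⟨Real.exp_le_exp.2 hJ'.1, Real.exp_le_exp.2 hJ'.2⟩
  have hIf : Real.exp (-(|J| * (n * N))) ≤ (∫ E, Real.exp (J * rectElecSum (Ls := Ls) ρ a E b)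
        ∂Measure.pi fun _ : RectTorusSite Ls => haarProbability G) ∧
      (∫ E, Real.exp (J * rectElecSum (Ls := Ls) ρ a E b) ∂Measure.pi fun _ : RectTorusSite Ls => haarProbability G) ≤
        Real.exp (|J| * (n * N)) := by
    have hpt : ∀ E : RectTorusSite Ls → G, Real.exp (-(|J| * (n * N))) ≤ Real.exp (J * rectElecSum (Ls := Ls) ρ a E b) ∧
        Real.exp (J * rectElecSum (Ls := Ls) ρ a E b) ≤ Real.exp (|J| * (n * N)) := by
      intro E
      have hJ : |J * rectElecSum (Ls := Ls) ρ a E b| ≤ |J| * (n * N) := by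
        rw [abs_mul]; exact mul_le_mul_of_nonneg_left (helec E) (abs_nonneg _)
      have hJ' := abs_le.1 hJ
      exact ⟨Real.exp_le_exp.2 hJ'.1, Real.exp_le_exp.2 hJ'.2⟩
    constructor
    · have h := integral_mono (integrable_const _) hEi fun E => (hpt E).1
      rwa [integral_const, smul_eq_mul, probReal_univ, one_mul] at h
    · have h := integral_mono hEi (integrable_const _) fun E => (hpt E).2
      rwa [integral_const, smul_eq_mul, probReal_univ, one_mul] at h
  have hsplit : ∀ s : ℝ, Real.exp (s * (|J| * (n * (P + N)))) =
      Real.exp (s * (|J| * (n * P) / 2)) * Real.exp (s * (|J| * (n * N))) * Real.exp (s * (|J| * (n * P) / 2)) := by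
    intro s; rw [← Real.exp_add, ← Real.exp_add]; congr 1; ring
  unfold rectSliceKernel
  constructor
  · have h := hsplit (-1)
    rw [neg_one_mul] at h
    rw [h]
    refine mul_le_mul (mul_le_mul ?_ ?_ (Real.exp_pos _).le (Real.exp_pos _).le) ?_ (Real.exp_pos _).le
      (mul_nonneg (Real.exp_pos _).le (integral_nonneg fun E => (Real.exp_pos _).le))
    · simpa only [neg_one_mul] using (hmf a).1
    · simpa only [neg_one_mul] using hIf.1
    · simpa only [neg_one_mul] using (hmf b).1
  · have h := hsplit 1
    simp only [one_mul] at h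
    rw [h]
    exact mul_le_mul (mul_le_mul (hmf a).2 hIf.2 (integral_nonneg fun E => (Real.exp_pos _).le) (Real.exp_pos _).le)
      (hmf b).2 (Real.exp_pos _).le (by positivity)

/-- **Vacuum expectations on the tube are Haar expectations up to `B_f (e^{4c} − 1)`**, `c = |J| n (#P+N)`, for every nonnegative
unit vacuum `Ω` of `T_J` (continuous unitary `ρ`) and every bounded strongly measurable `f`. [cite: ReedSimonIV1978, §XIII.12] -/
theorem rectTube_abs_vacuum_expectation_sub_haar_le (hρ : Continuous ρ) (hρu : ∀ g, ρ g ∈ Matrix.unitaryGroup (Fin n) ℂ) (J : ℝ)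
    {Ω : Lp ℝ 2 (rectSliceMeasure G Ls)} (h1 : ‖Ω‖ = 1) (hΩ : ∀ᵐ a ∂(rectSliceMeasure G Ls), 0 ≤ Ω a)
    (heig : rectTubeTransferOperator ρ J Ls Ω = ‖rectTubeTransferOperator ρ J Ls‖ • Ω)
    {f : RectSlice Ls G → ℝ} (hf : StronglyMeasurable f) {Bf : ℝ} (hBf : ∀ a, ‖f a‖ ≤ Bf) :
    |∫ a, f a * (Ω a * Ω a) ∂(rectSliceMeasure G Ls) - ∫ a, f a ∂(rectSliceMeasure G Ls)| ≤
      Bf * (Real.exp (4 * (|J| * (n * (Fintype.card (RectTorusSite Ls) * Fintype.card {p : Fin k × Fin k // p.1 < p.2} +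
        Fintype.card (RectTorusSite Ls × Fin k))))) - 1) := by
  set c : ℝ := |J| * (n * (Fintype.card (RectTorusSite Ls) * Fintype.card {p : Fin k × Fin k // p.1 < p.2} +
    Fintype.card (RectTorusSite Ls × Fin k))) with hc
  obtain ⟨C, hC⟩ := exists_rectSliceKernel_le (Ls := Ls) ρ hρ J J
  have hpinch := fun a b => rectSliceKernel_mem_Icc_exp ρ (Ls := Ls) hρ hρu J a b
  have h := abs_integral_mul_vacuum_sq_sub_integral_le (μ := rectSliceMeasure G Ls)
    (stronglyMeasurable_uncurry_rectSliceKernel ρ hρ J J) hC (Real.exp_pos (-c)) (fun a b => (hpinch a b).1)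
    (fun a b => (hpinch a b).2) (rectTubeTransferOperator_ae_eq J Ls hρ) (norm_rectTubeTransferOperator_pos J Ls hρ)
    h1 hΩ heig hf hBf
  have hratio : (Real.exp c / Real.exp (-c)) ^ 2 = Real.exp (4 * c) := by
    rw [← Real.exp_sub, ← Real.exp_nat_mul]; congr 1; push_cast; ring
  rw [hratio] at h
  exact h

end Tube

/-! ### The cell's `SU(2)` object -/

section SU2

variable {k : ℕ}

/-- **`SU(2)` (`J = β/2`, `n = 2`): `|⟨f⟩_Ω − ⟨f⟩_Haar| ≤ B_f (e^{4β(#sites·k(k−1)/2 + #sites·k)} − 1)`** for every nonnegative unit vacuum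
`Ω` of the `SU(2)` tube at Wilson coupling `β` — e.g. `f = ½Tr U_p` (`B_f = 1`): the vacuum plaquette expectation is within
`e^{4β(#P+N)} − 1` of its Haar value (`0` for a plaquette with four distinct links, `¼` for a one-site commutator plaquette).
[cite: MontvayMunster1994, §3.2.6] -/
theorem su2_rectTube_abs_vacuum_expectation_sub_haar_le (β : ℝ) (Ls : Fin k → ℕ) [∀ i, NeZero (Ls i)]
    {Ω : Lp ℝ 2 (rectSliceMeasure (Matrix.specialUnitaryGroup (Fin 2) ℂ) Ls)} (h1 : ‖Ω‖ = 1)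
    (hΩ : ∀ᵐ a ∂(rectSliceMeasure (Matrix.specialUnitaryGroup (Fin 2) ℂ) Ls), 0 ≤ Ω a)
    (heig : rectTubeTransferOperator (fundamentalRep (Fin 2)) (β / 2) Ls Ω =
      ‖rectTubeTransferOperator (fundamentalRep (Fin 2)) (β / 2) Ls‖ • Ω)
    {f : RectSlice Ls (Matrix.specialUnitaryGroup (Fin 2) ℂ) → ℝ} (hf : StronglyMeasurable f) {Bf : ℝ} (hBf : ∀ a, ‖f a‖ ≤ Bf) :
    |∫ a, f a * (Ω a * Ω a) ∂(rectSliceMeasure (Matrix.specialUnitaryGroup (Fin 2) ℂ) Ls) -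
        ∫ a, f a ∂(rectSliceMeasure (Matrix.specialUnitaryGroup (Fin 2) ℂ) Ls)| ≤
      Bf * (Real.exp (4 * (|β| * (Fintype.card (RectTorusSite Ls) * Fintype.card {p : Fin k × Fin k // p.1 < p.2} +
        Fintype.card (RectTorusSite Ls × Fin k)))) - 1) := by
  haveI : SecondCountableTopology (Matrix.specialUnitaryGroup (Fin 2) ℂ) :=
    Literature.MathematicalPhysics.QuantumLattice.secondCountableTopology_su2
  have h := rectTube_abs_vacuum_expectation_sub_haar_le (fundamentalRep (Fin 2)) (Ls := Ls) (continuous_fundamentalRep (Fin 2))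
    fundamentalRep_mem_unitaryGroup (β / 2) h1 hΩ heig hf hBf
  have h2 : |β / 2| * ((2 : ℕ) * ((Fintype.card (RectTorusSite Ls) : ℝ) * Fintype.card {p : Fin k × Fin k // p.1 < p.2} +
      Fintype.card (RectTorusSite Ls × Fin k))) =
      |β| * (Fintype.card (RectTorusSite Ls) * Fintype.card {p : Fin k × Fin k // p.1 < p.2} +
        Fintype.card (RectTorusSite Ls × Fin k)) := by
    rw [abs_div, abs_two]; push_cast; ring
  rw [h2] at h
  exact h

end SU2

end Summit.Ventures.YMGap.FlowData
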